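import Literature.AlgebraicGeometry.Resolution.DivisorialPart
import Literature.AlgebraicGeometry.Resolution.ReducedSubschemes
import HarnessLib

/-!
# An effective Cartier divisor on a regular scheme is reduced iff it has order one at its codimension-one points

Topic: `Literature/AlgebraicGeometry/Resolution`. Theorem-only file (sorry-free, no definitions, no named facts).

On a regular integral Noetherian scheme `X` the local rings are factorial (Auslander–Buchsbaum, tree
`Scheme.IsRegular.uniqueFactorizationMonoid_stalk`), so a non-zero locally principal ideal sheaf `I` IS its divisorial
part `∏ᵢ 𝓘_{E_i}^{a(i)}` over the codimension-one points `ζᵢ` of `V(I)` (`E_i = cl{ζᵢ}`, `a(i) = ord_{ζᵢ} I`;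
Cossart–Piltant 2008, proof of Prop. 4.2, first paragraph; tree `DivisorialPart.lean`: `divisorialPart`,
`isLocallyPrincipal_iff_codimTwoPart_eq_top`, `divisorialPart_mul_codimTwoPart`), with stalks `(∏_{ζ ⤳ x} p_ζ^{a(ζ)})`,
the `p_ζ` pairwise non-associated primes of the factorial `𝒪_{X,x}` (Stacks 01J7 / 0BE1). Hence the classical criterion:

* `radical_eq_of_isLocallyPrincipal_of_forall_idealOrder_eq_one` — **if `ord_ζ I = 1` at every codimension-one point
  `ζ` of `V(I)` then `√I = I`** (`∏ p_ζ` with DISTINCT prime factors is a radical element);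
* `idealOrder_eq_one_of_radical_eq` — **conversely `√I = I` forces `ord_ζ I = 1`** at the codimension-one points
  (`I_ζ = 𝔪_ζ^{a}` in the discrete valuation ring `𝒪_{X,ζ}`, and `𝔪^a` is radical only for `a = 1`);
* `radical_eq_iff_forall_idealOrder_eq_one`, `isReduced_subscheme_iff_forall_idealOrder_eq_one`,
  `eq_vanishingIdeal_support_iff_forall_idealOrder_eq_one` — the packaged equivalences («`V(I)` is reduced», «`I` is
  the ideal of its support»).

Use (res-hironaka, chain W5.2, T5-E «W₂B-maxweight»): the CARRIED REDUCED HOST of the E-side transport (the iterated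
controlled transform, with generic order, of a reduced Cartier divisor) stays reduced — its codimension-one points lie
off the exceptional divisors, where orders are unchanged — so that at the end it IS the ideal of the (regular) strict
transform delivered by Cossart–Jannsen–Saito.

## References
* V. Cossart, O. Piltant, J. Algebra 320 (2008) 1051–1082, proof of Prop. 4.2 (first paragraph). [CossartPiltant2008]
* U. Görtz, T. Wedhorn, *Algebraic Geometry I* (2nd ed. 2020), Thm. 11.40 (2); Prop. 3.27 (1). [GortzWedhorn2020]
* The Stacks Project, Tags 0BE1, 01J7, 0AFW. [StacksProject]
-/

noncomputable section

open CategoryTheory CategoryTheory.Limits AlgebraicGeometry TopologicalSpace IsLocalRing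

namespace Literature.AlgebraicGeometry.Resolution

universe u

open Scheme.IdealSheafData

variable {X : Scheme.{u}} [IsIntegral X] [IsNoetherian X]

/-! ## The stalks of the divisorial part, with their prime factorisation exposed -/

/-- **The stalk of the divisorial part is generated by `∏_{ζ ⤳ x} p_ζ^{a(ζ)}`** with `p_ζ` a prime generator of the
prime `𝔭_ζ ⊆ 𝒪_{X,x}` of each codimension-one point `ζ ⤳ x` of `V(I)`, these primes being pairwise non-associated
(re-exposing the construction inside the tree's `exists_stalkIdeal_divisorialPart_eq_span`).
[cite: CossartPiltant2008, proof of Prop. 4.2] [cite: StacksProject, Tag 01J7] -/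
theorem exists_primes_stalkIdeal_divisorialPart_eq (hX : Scheme.IsRegular X) {I : X.IdealSheafData}
    (hI : I ≠ ⊥) (x : X) :
    ∃ (T : Finset X) (q : X → X.presheaf.stalk x),
      (∀ ζ ∈ T, ζ ∈ divisorialPoints I) ∧ (∀ ζ, ζ ∈ divisorialPoints I → ζ ⤳ x → ζ ∈ T) ∧
      (∀ ζ ∈ T, ζ ⤳ x → Prime (q ζ)) ∧ (∀ ζ ∈ T, ¬ ζ ⤳ x → q ζ = 1) ∧
      (∀ ζ ∈ T, ∀ ζ' ∈ T, ζ ⤳ x → ζ' ⤳ x → ζ ≠ ζ' → ¬ q ζ ∣ q ζ') ∧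
      stalkIdeal (divisorialPart I) x = Ideal.span {∏ ζ ∈ T, q ζ ^ (idealOrder I ζ).toNat} := by
  classical
  haveI := hX.uniqueFactorizationMonoid_stalk x
  set T := (finite_divisorialPoints hI).toFinset with hT
  have hTmem : ∀ ζ ∈ T, ζ ∈ divisorialPoints I := fun ζ h => (Set.Finite.mem_toFinset _).mp h
  have hq : ∀ ζ : {ζ // ζ ∈ T ∧ ζ ⤳ x}, ∃ q : X.presheaf.stalk x,
      Prime q ∧ primeOfSpecializes ζ.2.2 = Ideal.span {q} :=
    fun ζ => exists_prime_primeOfSpecializes_eq_span ζ.2.2 (hTmem ζ ζ.2.1).2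
  choose q hqprime hqspan using hq
  let q' : X → X.presheaf.stalk x := fun ζ => if h : ζ ∈ T ∧ ζ ⤳ x then q ⟨ζ, h⟩ else 1
  have hq'_pos : ∀ (ζ : X) (h : ζ ∈ T ∧ ζ ⤳ x), q' ζ = q ⟨ζ, h⟩ := fun ζ h => dif_pos h
  have hq'_neg : ∀ ζ : X, ¬ ζ ⤳ x → q' ζ = 1 := fun ζ h => dif_neg fun hh => h hh.2
  have hstalk : ∀ ζ ∈ T, stalkIdeal (primeDivisorIdeal ζ) x = Ideal.span {q' ζ} := by
    intro ζ hζ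
    by_cases h : ζ ⤳ x
    · rw [hq'_pos ζ ⟨hζ, h⟩, stalkIdeal_primeDivisorIdeal h]
      exact hqspan ⟨ζ, hζ, h⟩
    · rw [hq'_neg ζ h, stalkIdeal_primeDivisorIdeal_eq_top h, Ideal.span_singleton_one]
  refine ⟨T, q', hTmem, fun ζ hζ _ => (Set.Finite.mem_toFinset _).mpr hζ,
    fun ζ hζ h => (hq'_pos ζ ⟨hζ, h⟩) ▸ hqprime _, fun ζ _ h => hq'_neg ζ h, ?_, ?_⟩
  · intro ζ hζ ζ' hζ' h h' hne hdvd
    have hle : primeOfSpecializes h' ≤ primeOfSpecializes h := by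
      rw [hqspan ⟨ζ, hζ, h⟩, hqspan ⟨ζ', hζ', h'⟩, ← hq'_pos ζ ⟨hζ, h⟩, ← hq'_pos ζ' ⟨hζ', h'⟩]
      exact Ideal.span_singleton_le_span_singleton.mpr hdvd
    exact not_specializes_of_coheight_eq_one (hTmem ζ' hζ').2 (hTmem ζ hζ).2 (Ne.symm hne)
      (specializes_of_primeOfSpecializes_le h h' hle)
  · rw [divisorialPart_eq (finite_divisorialPoints hI), stalkIdeal_finset_prod, ← Ideal.prod_span_singleton]
    refine Finset.prod_congr rfl fun ζ hζ => ?_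
    rw [stalkIdeal_pow, hstalk ζ hζ, Ideal.span_singleton_pow]

/-- **A product of pairwise non-associated primes (each to the power one) generates a radical ideal** in a domain:
`√(∏ p_ζ) = (∏ p_ζ)`. [cite: StacksProject, Tag 0AFW] -/
theorem radical_span_singleton_prod_eq {R : Type*} [CommRing R] [IsDomain R] {ι : Type*} (s : Finset ι)
    (q : ι → R) (hq : ∀ i ∈ s, Prime (q i)) (hna : ∀ i ∈ s, ∀ j ∈ s, i ≠ j → ¬ q i ∣ q j) :
    (Ideal.span {∏ i ∈ s, q i}).radical = Ideal.span {∏ i ∈ s, q i} := by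
  refine le_antisymm (fun y hy => ?_) Ideal.le_radical
  obtain ⟨n, hn⟩ := hy
  rw [Ideal.mem_span_singleton] at hn ⊢
  have h1 : (∏ i ∈ s, q i ^ 1) ∣ y := by
    refine Finset.prod_pow_dvd_of_forall_pow_dvd q (fun _ => 1) s hq hna fun i hi => ?_
    rw [pow_one]
    exact (hq i hi).dvd_of_dvd_pow ((Finset.dvd_prod_of_mem q hi).trans hn)
  simpa using h1

/-! ## Order one at the codimension-one points ⇒ reduced -/

/-- **The stalks of the divisorial part are radical when all the orders `a(ζ)` are one.**
[cite: CossartPiltant2008, proof of Prop. 4.2] [cite: StacksProject, Tag 0AFW] -/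
theorem radical_stalkIdeal_divisorialPart_of_forall_idealOrder_eq_one (hX : Scheme.IsRegular X)
    {I : X.IdealSheafData} (hI : I ≠ ⊥) (hord : ∀ ζ ∈ divisorialPoints I, idealOrder I ζ = 1) (x : X) :
    (stalkIdeal (divisorialPart I) x).radical = stalkIdeal (divisorialPart I) x := by
  classical
  obtain ⟨T, q, hT, -, hprime, hone, hna, hst⟩ := exists_primes_stalkIdeal_divisorialPart_eq hX hI x
  -- all exponents are one; the non-generisations contribute the factor `1`
  have hprod : ∏ ζ ∈ T, q ζ ^ (idealOrder I ζ).toNat = ∏ ζ ∈ T.filter (· ⤳ x), q ζ := by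
    rw [Finset.prod_filter]
    refine Finset.prod_congr rfl fun ζ hζ => ?_
    rw [hord ζ (hT ζ hζ)]
    split_ifs with h
    · simp
    · rw [hone ζ hζ h]; simp
  rw [hst, hprod]
  refine radical_span_singleton_prod_eq _ q (fun ζ hζ => ?_) (fun ζ hζ ζ' hζ' hne => ?_)
  · obtain ⟨hζT, h⟩ := Finset.mem_filter.mp hζ
    exact hprime ζ hζT h
  · obtain ⟨hζT, h⟩ := Finset.mem_filter.mp hζ
    obtain ⟨hζ'T, h'⟩ := Finset.mem_filter.mp hζ'
    exact hna ζ hζT ζ' hζ'T h h' hne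

/-- A non-zero locally principal ideal sheaf on a regular integral Noetherian scheme IS its divisorial part
(`J = 𝒪_X` in Cossart–Piltant's decomposition `I = H · J`). [cite: CossartPiltant2008, proof of Prop. 4.2] -/
theorem divisorialPart_eq_self_of_isLocallyPrincipal (hX : Scheme.IsRegular X) {I : X.IdealSheafData} (hI : I ≠ ⊥)
    (hlp : IsLocallyPrincipal I) : divisorialPart I = I := by
  have h := divisorialPart_mul_codimTwoPart hX hI
  rwa [(isLocallyPrincipal_iff_codimTwoPart_eq_top hX hI).mp hlp, Scheme.IdealSheafData.mul_top] at h

/-- **Order one at every codimension-one point of its support makes a Cartier divisor reduced**: for a non-zero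
locally principal `I` on a regular integral Noetherian scheme, `ord_ζ I = 1` for all codimension-one `ζ ∈ V(I)` implies
`√I = I`. [cite: CossartPiltant2008, proof of Prop. 4.2] [cite: StacksProject, Tag 0AFW] -/
theorem radical_eq_of_isLocallyPrincipal_of_forall_idealOrder_eq_one (hX : Scheme.IsRegular X)
    {I : X.IdealSheafData} (hI : I ≠ ⊥) (hlp : IsLocallyPrincipal I)
    (hord : ∀ ζ ∈ divisorialPoints I, idealOrder I ζ = 1) : I.radical = I := by
  refine ext_of_forall_stalkIdeal_eq fun x => ?_
  rw [stalkIdeal_radical, ← divisorialPart_eq_self_of_isLocallyPrincipal hX hI hlp]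
  exact radical_stalkIdeal_divisorialPart_of_forall_idealOrder_eq_one hX hI hord x

/-! ## Reduced ⇒ order one at the codimension-one points -/

/-- **A reduced non-zero ideal sheaf has order one at the codimension-one points of its support**: there
`I_ζ = 𝔪_ζ^{a}`, `a = ord_ζ I ≥ 1`, in the one-dimensional regular local ring `𝒪_{X,ζ}`, and `𝔪^a` is radical only for
`a = 1` (Nakayama: `𝔪² ≠ 𝔪`). [cite: CossartPiltant2008, proof of Prop. 4.2] [cite: StacksProject, Tag 00NQ] -/
theorem idealOrder_eq_one_of_radical_eq (hX : Scheme.IsRegular X) {I : X.IdealSheafData} (hI : I ≠ ⊥)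
    (hrad : I.radical = I) {ζ : X} (hζ : ζ ∈ divisorialPoints I) : idealOrder I ζ = 1 := by
  obtain ⟨a, ha, he⟩ := exists_stalkIdeal_eq_maximalIdeal_pow hX hζ.2 hI
  -- `a ≥ 1` since `ζ ∈ V(I)`
  have ha0 : a ≠ 0 := by
    rintro rfl
    have h1 : stalkIdeal I ζ ≤ maximalIdeal _ := (mem_support_iff_stalkIdeal_le I ζ).mp hζ.1
    rw [he, pow_zero, Ideal.one_eq_top, top_le_iff] at h1
    exact (maximalIdeal.isMaximal _).ne_top h1
  -- `𝔪^a` is radical, so `𝔪^a = 𝔪`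
  have hradζ : (stalkIdeal I ζ).radical = stalkIdeal I ζ := by
    rw [← stalkIdeal_radical, hrad]
  rw [he, Ideal.radical_pow _ ha0, (maximalIdeal.isMaximal _).isPrime.radical] at hradζ
  -- hence `a = 1`
  obtain ⟨b, rfl⟩ := Nat.exists_eq_succ_of_ne_zero ha0
  rcases Nat.eq_zero_or_pos b with rfl | hb
  · simpa using ha
  · exfalso
    have hnf := not_isField_stalk_of_coheight_eq_one (X := X) hζ.2
    -- `𝔪^{b+1} ≤ 𝔪² ≤ 𝔪 = 𝔪^{b+1}` gives `𝔪² = 𝔪`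
    have h2 : maximalIdeal (X.presheaf.stalk ζ) ^ 2 = maximalIdeal (X.presheaf.stalk ζ) ^ 1 := by
      refine le_antisymm (Ideal.pow_le_pow_right (by norm_num)) ?_
      rw [pow_one]
      calc maximalIdeal (X.presheaf.stalk ζ) = maximalIdeal _ ^ (b + 1) := hradζ
        _ ≤ maximalIdeal _ ^ 2 := Ideal.pow_le_pow_right (by omega)
    exact maximalIdeal_pow_succ_ne hnf 1 h2

/-! ## The packaged criteria -/

/-- **A Cartier divisor on a regular scheme is reduced iff it has order one at its codimension-one points.**
[cite: CossartPiltant2008, proof of Prop. 4.2] [cite: StacksProject, Tag 0AFW] -/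
theorem radical_eq_iff_forall_idealOrder_eq_one (hX : Scheme.IsRegular X) {I : X.IdealSheafData} (hI : I ≠ ⊥)
    (hlp : IsLocallyPrincipal I) : I.radical = I ↔ ∀ ζ ∈ divisorialPoints I, idealOrder I ζ = 1 :=
  ⟨fun h _ hζ => idealOrder_eq_one_of_radical_eq hX hI h hζ,
    radical_eq_of_isLocallyPrincipal_of_forall_idealOrder_eq_one hX hI hlp⟩

/-- The same with «`V(I)` is a reduced scheme». [cite: GortzWedhorn2020, Prop. 3.27 (1)] -/
theorem isReduced_subscheme_iff_forall_idealOrder_eq_one (hX : Scheme.IsRegular X) {I : X.IdealSheafData}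
    (hI : I ≠ ⊥) (hlp : IsLocallyPrincipal I) :
    IsReduced I.subscheme ↔ ∀ ζ ∈ divisorialPoints I, idealOrder I ζ = 1 := by
  rw [isReduced_subscheme_iff_radical_eq, radical_eq_iff_forall_idealOrder_eq_one hX hI hlp]

/-- The same with «`I` is the ideal of its support». [cite: GortzWedhorn2020, Prop. 3.27 (1)] -/
theorem eq_vanishingIdeal_support_iff_forall_idealOrder_eq_one (hX : Scheme.IsRegular X) {I : X.IdealSheafData}
    (hI : I ≠ ⊥) (hlp : IsLocallyPrincipal I) :
    I = vanishingIdeal I.support ↔ ∀ ζ ∈ divisorialPoints I, idealOrder I ζ = 1 := by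
  rw [vanishingIdeal_support, ← radical_eq_iff_forall_idealOrder_eq_one hX hI hlp, eq_comm]

/-! ## rev 2 (append-only): the same prime generators also present the prime divisor ideals -/

/-- **The stalk of the divisorial part with its prime generators, the SAME generators presenting the prime divisor ideals**
(`𝓟_ζ,x = (q ζ)` for `ζ ∈ T`): the form needed to compare `I` with products of powers of the `𝓟_ζ` stalkwise.
[cite: CossartPiltant2008, proof of Prop. 4.2] [cite: StacksProject, Tag 01J7] -/
theorem exists_primes_stalkIdeal_divisorialPart_eq' (hX : Scheme.IsRegular X) {I : X.IdealSheafData}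
    (hI : I ≠ ⊥) (x : X) :
    ∃ (T : Finset X) (q : X → X.presheaf.stalk x),
      (∀ ζ ∈ T, ζ ∈ divisorialPoints I) ∧ (∀ ζ, ζ ∈ divisorialPoints I → ζ ⤳ x → ζ ∈ T) ∧
      (∀ ζ ∈ T, ζ ⤳ x → Prime (q ζ)) ∧ (∀ ζ ∈ T, ¬ ζ ⤳ x → q ζ = 1) ∧
      (∀ ζ ∈ T, stalkIdeal (primeDivisorIdeal ζ) x = Ideal.span {q ζ}) ∧
      stalkIdeal (divisorialPart I) x = Ideal.span {∏ ζ ∈ T, q ζ ^ (idealOrder I ζ).toNat} := by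
  classical
  haveI := hX.uniqueFactorizationMonoid_stalk x
  set T := (finite_divisorialPoints hI).toFinset with hT
  have hTmem : ∀ ζ ∈ T, ζ ∈ divisorialPoints I := fun ζ h => (Set.Finite.mem_toFinset _).mp h
  have hq : ∀ ζ : {ζ // ζ ∈ T ∧ ζ ⤳ x}, ∃ q : X.presheaf.stalk x,
      Prime q ∧ primeOfSpecializes ζ.2.2 = Ideal.span {q} :=
    fun ζ => exists_prime_primeOfSpecializes_eq_span ζ.2.2 (hTmem ζ ζ.2.1).2
  choose q hqprime hqspan using hq
  let q' : X → X.presheaf.stalk x := fun ζ => if h : ζ ∈ T ∧ ζ ⤳ x then q ⟨ζ, h⟩ else 1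
  have hq'_pos : ∀ (ζ : X) (h : ζ ∈ T ∧ ζ ⤳ x), q' ζ = q ⟨ζ, h⟩ := fun ζ h => dif_pos h
  have hq'_neg : ∀ ζ : X, ¬ ζ ⤳ x → q' ζ = 1 := fun ζ h => dif_neg fun hh => h hh.2
  have hstalk : ∀ ζ ∈ T, stalkIdeal (primeDivisorIdeal ζ) x = Ideal.span {q' ζ} := by
    intro ζ hζ
    by_cases h : ζ ⤳ x
    · rw [hq'_pos ζ ⟨hζ, h⟩, stalkIdeal_primeDivisorIdeal h]
      exact hqspan ⟨ζ, hζ, h⟩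
    · rw [hq'_neg ζ h, stalkIdeal_primeDivisorIdeal_eq_top h, Ideal.span_singleton_one]
  refine ⟨T, q', hTmem, fun ζ hζ _ => (Set.Finite.mem_toFinset _).mpr hζ,
    fun ζ hζ h => (hq'_pos ζ ⟨hζ, h⟩) ▸ hqprime _, fun ζ _ h => hq'_neg ζ h, hstalk, ?_⟩
  rw [divisorialPart_eq (finite_divisorialPoints hI), stalkIdeal_finset_prod, ← Ideal.prod_span_singleton]
  refine Finset.prod_congr rfl fun ζ hζ => ?_
  rw [stalkIdeal_pow, hstalk ζ hζ, Ideal.span_singleton_pow]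

end Literature.AlgebraicGeometry.Resolution

end
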